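/-
Copyright (c) 2026 the pub-hodgecm-mathlib formalisation cell (harness21).  Prover seat hodgecm-mathlib-LH4-p07 (g9), req620 Track A «(D-RAM) FOUR-FRAME» squad
(STAGE-1b, row-(2) lineage; dealer LH4-plan (g13) WORD #94 (1) ∕ #97 ∕ #98 (2): the RamM lane of the level law — cut reindex for (R3)), 2026-09-04.
-/
import Summits.HodgeConjecture.HodgeConjecture.Theorems.F0P3cDyRamToricCensusSumRamMReindex   -- ★ (LH4-p06): `ncard_levelSetDep_eq_zero_of_succ_le_ramified`, brings ★ (R1-A0) `levelSetDep_zero_eq_of_ramified`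
import HarnessLib

/-!
# Crux `H413`, line LH4 «(D-RAM) FOUR-FRAME» — STAGE-1b, row (2): (T5-P-reindex-RamM) «THE CUT ORDER COUNTS OF A LEVEL PIECE RE-INDEXED, TYPE RamM»
# `Σ_{j≤jλ} #levelSet(j,0) + Σ_{b∈Icc 1 R} Σ_{j≤jλ} [j + b ≤ C]·q^b·#levelSetDep(j,b;μ) = Σ_{j≤jλ} Σ_{a<jλ+2} q^a·[j + a ≤ C]·#levelSetDep(j,a;μ)`

Cell `hodgecm-mathlib` (D-0151), FLOOR 0, crux item H413 = `stmt-HodgeConjecture-24833`, route of record `HCCMUnconditional`; squad F0∕P3c∕LH4; lane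
`--supports stmt-HodgeConjecture-24833 --as helper` (count-neutral; pays NO tier-0 row).  THEOREMS ONLY (no `def`, no instance, no notation, no `sorry`).
OWNER'S ORGAN №19 — the RamM twin of ★ p859781 `F0P3cDyRamToricCensusSumCutReindex` (the organ (R3) «OC-weld RamM», LH4-p10 (g6) per WORD #98 (2), composes with):
★ `ncard_levelSet_zero_add_sum_Icc_eq_sum_range_ramified`'s proof WITH THE DIAGONAL CUTOFF `[j + a ≤ C]` inside both sums (the axis `a = 0` is uncut since `j ≤ jλ ≤ C`).
Ramified token letters (★ `orderCountCensusC`'s): `IsRamifiedQuadraticDatum ρ α d_ρ t` (at the CM place `α := ϖM`), `|ϖE| = exp(−2)`, `|μ| = |ϖE|^m`, `|μ − ρμ| = |ϖE^{jλ}(α − ρα)|`.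
* §1 `ncard_levelSet_zero_add_sum_Icc_cut_eq_sum_range_ramified` — one row `j ≤ jλ ≤ C`, `R ≥ jλ + 1`.
* §2 **`cutOrderCounts_eq_cutCensusSum_of_cells_ramified`** — the whole side under the cell-depth letter `hRcells : ∀ j b, 1 ≤ b → lam ∈ 𝒪_j → levelSetDep(j,b;μ) ≠ ∅ → b ≤ R`
  (rows `range (jλ + 1)`, the conductor of `μ`; `hiff : lam ∈ 𝒪_j ↔ j ≤ jλ`).
HONEST LABEL.  Count-neutral bookkeeping; `HC_CM` is proved only modulo the 7 printed citations (2 remaining named inputs: hLiu418 = `stmt-HodgeConjecture-24832`, h413 =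
`stmt-HodgeConjecture-24833`) until rung 0 closes.

## References
* [Kottwitz1986BaseChangeUnits] R. E. Kottwitz, *Base change for unit elements of Hecke algebras*, Compositio Math. 60 (1986): §1 pp. 240–241.
* [Rogawski1990] J. D. Rogawski, *Automorphic Representations of Unitary Groups in Three Variables*, Ann. of Math. Stud. 123 (1990): §4.9 Prop. 4.9.1 (b) p. 55, Lemma 4.9.3 p. 56.
* [Jacobowitz1962] R. Jacobowitz, *Hermitian forms over local fields*, Amer. J. Math. 84 (1962): §4.
-/

set_option autoImplicit false

open WithZero IsLocalRing Finset
open scoped Valued Classical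

namespace Summit.HodgeConjecture.HodgeConjecture.Cruxes.H413.F0P3cDyRamToricCensusSumRamMCutReindex

open Literature.NumberTheory.Automorphic.UnitaryThreeFourFrame (IsRamifiedQuadraticDatum)
open Summit.HodgeConjecture.HodgeConjecture.Cruxes.H413.F0P3cDyRamToricCensusDefs
open Summit.HodgeConjecture.HodgeConjecture.Cruxes.H413.F0P3cDyRamToricLevelCensusRamM

variable {K : Type} [Field K] [Valued K ℤᵐ⁰] {ρ Θ : K →+* K} {α ϖE h : K} {dρ t : ℕ}

/-! ## §1 One row -/

/-- **ONE ROW, WITH THE CUTOFF (RamM)** (`j ≤ jλ ≤ C`, `R ≥ jλ + 1`): `#levelSet(j,0) + Σ_{b ∈ Icc 1 R} [j + b ≤ C]·q^b·#levelSetDep(j,b;μ) = Σ_{a<jλ+2} q^a·[j + a ≤ C]·#levelSetDep(j,a;μ)`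
— the `a = 0` cell is uncut and passes the depth test (★ (R1-A0) `levelSetDep_zero_eq_of_ramified`), the cells `a ≥ j + 1` are empty (★ `ncard_levelSetDep_eq_zero_of_succ_le_ramified`).
[cite: Kottwitz1986BaseChangeUnits, §1 pp. 240–241] [cite: Jacobowitz1962, §4] -/
theorem ncard_levelSet_zero_add_sum_Icc_cut_eq_sum_range_ramified (hD : IsRamifiedQuadraticDatum ρ α dρ t) (hΘΘ : ∀ x, Θ (Θ x) = x)
    (hΘρ : ∀ x, Θ (ρ x) = ρ (Θ x)) (hvΘ : ∀ x, Valued.v (Θ x) = Valued.v x) (hρϖ : ρ ϖE = ϖE) (hϖE : Valued.v ϖE = exp (-2 : ℤ)) (hh : h ≠ 0)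
    {μ : K} {m jl : ℕ} (hμ : Valued.v μ = Valued.v ϖE ^ m) (hjl : Valued.v (μ - ρ μ) = Valued.v (ϖE ^ jl * (α - ρ α))) (q : ℕ)
    {j : ℕ} (hj : j ≤ jl) {R : ℕ} (hR : jl + 1 ≤ R) {C : ℕ} (hC : jl ≤ C) :
    (levelSet ρ Θ α ϖE h j 0).ncard + ∑ b ∈ Icc 1 R, (if j + b ≤ C then q ^ b * (levelSetDep ρ Θ α ϖE h j b μ).ncard else 0) =
      ∑ a ∈ range (jl + 2), q ^ a * (if j + a ≤ C then (levelSetDep ρ Θ α ϖE h j a μ).ncard else 0) := by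
  set f : ℕ → ℕ := fun a => q ^ a * (if j + a ≤ C then (levelSetDep ρ Θ α ϖE h j a μ).ncard else 0) with hf
  have hf0 : ∀ a, jl + 2 ≤ a → f a = 0 := fun a ha => by
    rw [hf]; dsimp only
    rw [ncard_levelSetDep_eq_zero_of_succ_le_ramified (Θ := Θ) hD hvΘ hρϖ hϖE hh μ (by omega : j + 1 ≤ a), ite_self, mul_zero]
  have hfb : ∀ b, (if j + b ≤ C then q ^ b * (levelSetDep ρ Θ α ϖE h j b μ).ncard else 0) = f b := fun b => by
    rw [hf]; dsimp only
    split_ifs <;> simp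
  have hL : (levelSet ρ Θ α ϖE h j 0).ncard + ∑ b ∈ Icc 1 R, f b = ∑ a ∈ range (R + 1), f a := by
    rw [sum_range_succ', ← Finset.Ico_add_one_right_eq_Icc, sum_Ico_eq_sum_range, add_comm]
    congr 1
    · refine sum_congr (by rw [Nat.add_sub_cancel]) fun k _ => by rw [add_comm]
    · rw [hf]; dsimp only
      rw [pow_zero, one_mul, if_pos (by omega), levelSetDep_zero_eq_of_ramified hD hΘΘ hΘρ hvΘ hρϖ hϖE hh hμ hjl hj]
  have hRHS : ∑ a ∈ range (jl + 2), f a = ∑ a ∈ range (R + 1), f a :=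
    sum_subset (range_subset_range.2 (by omega)) fun a _ hna => hf0 a (by rw [mem_range, not_lt] at hna; omega)
  rw [Finset.sum_congr rfl fun b _ => hfb b, hL, hRHS]

/-! ## §2 The whole side, tube bound on cells -/

/-- **THE CUT ORDER COUNTS RE-INDEXED, CELL-BOUND FORM (RamM)** (one scalar `h`, any multiplier `μ` with ramified tokens `(m, jλ)`, `jλ ≤ C`; `hRcells`: the non-empty
cone cells of the rows `j ≤ jλ` have `b ≤ R`): the RamM twin of ★ p859781 `cutOrderCounts_eq_cutCensusSum_of_cells`, i.e. the cut twin of ★ `orderCounts_eq_censusSum_ramM_of_cells`.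
[cite: Kottwitz1986BaseChangeUnits, §1 pp. 240–241] [cite: Rogawski1990, §4.9 Prop. 4.9.1 (b) p. 55, Lemma 4.9.3 p. 56] -/
theorem cutOrderCounts_eq_cutCensusSum_of_cells_ramified (hD : IsRamifiedQuadraticDatum ρ α dρ t) (hΘΘ : ∀ x, Θ (Θ x) = x)
    (hΘρ : ∀ x, Θ (ρ x) = ρ (Θ x)) (hvΘ : ∀ x, Valued.v (Θ x) = Valued.v x) (hρϖ : ρ ϖE = ϖE) (hϖE : Valued.v ϖE = exp (-2 : ℤ)) (hh : h ≠ 0)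
    {μ : K} {m jl : ℕ} (hμ : Valued.v μ = Valued.v ϖE ^ m) (hjl : Valued.v (μ - ρ μ) = Valued.v (ϖE ^ jl * (α - ρ α))) (q : ℕ)
    {lam : K} (hiff : ∀ j, IsOrd ρ α (ϖE ^ j) lam ↔ j ≤ jl) {C : ℕ} (hC : jl ≤ C) {R : ℕ}
    (hRcells : ∀ j b, 1 ≤ b → IsOrd ρ α (ϖE ^ j) lam → (levelSetDep ρ Θ α ϖE h j b μ).Nonempty → b ≤ R) :
    (∑ j ∈ range (jl + 1), (levelSet ρ Θ α ϖE h j 0).ncard) +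
        ∑ b ∈ Icc 1 R, ∑ j ∈ range (jl + 1), (if j + b ≤ C then q ^ b * (levelSetDep ρ Θ α ϖE h j b μ).ncard else 0) =
      ∑ j ∈ range (jl + 1), ∑ a ∈ range (jl + 2), q ^ a * (if j + a ≤ C then (levelSetDep ρ Θ α ϖE h j a μ).ncard else 0) := by
  rw [sum_comm, ← sum_add_distrib]
  refine sum_congr rfl fun j hj' => ?_
  have hj : j ≤ jl := by rw [mem_range] at hj'; omega
  have hext : ∑ b ∈ Icc 1 R, (if j + b ≤ C then q ^ b * (levelSetDep ρ Θ α ϖE h j b μ).ncard else 0) =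
      ∑ b ∈ Icc 1 (max R (jl + 1)), (if j + b ≤ C then q ^ b * (levelSetDep ρ Θ α ϖE h j b μ).ncard else 0) := by
    refine sum_subset (Icc_subset_Icc_right (le_max_left _ _)) fun b hb hnb => ?_
    rw [mem_Icc] at hb hnb
    have hempty : levelSetDep ρ Θ α ϖE h j b μ = ∅ :=
      Set.not_nonempty_iff_eq_empty.1 fun hne => hnb ⟨hb.1, hRcells j b hb.1 ((hiff j).2 hj) hne⟩
    rw [hempty, Set.ncard_empty, mul_zero, ite_self]
  rw [hext]
  exact ncard_levelSet_zero_add_sum_Icc_cut_eq_sum_range_ramified hD hΘΘ hΘρ hvΘ hρϖ hϖE hh hμ hjl q hj (le_max_right _ _) hC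

end Summit.HodgeConjecture.HodgeConjecture.Cruxes.H413.F0P3cDyRamToricCensusSumRamMCutReindex
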